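import Summits.NavierStokesRegularity.NavierStokesRegularity.Theorems.ExtremiserTransienceTwoThirdsDefs
import HarnessLib

/-!
# Route `ExtremiserTransience`, crux `NearExtremalTransiencePerFlow` (stmt-NavierStokesRegularity-26567),
# LINE g10-1 «two_thirds» (ns-idea-10), stub S1a′ — texts of record: the NORMALISED form of `TypicalSelectionLarge`

`--supports stmt-NavierStokesRegularity-26567` (prover seat ns-net-p2 g12).  `TypicalSelectionNormalised` = `TypicalSelectionLarge` (p725367) restricted
to height `1`, Taylor length `1` (`IsAdm w 1 B`, `lam w = 1`), with linear growth `∫_{B(y,r)}|w|² ≤ A_E r`, goodness `locGain κ⋆ 1 w φ ≤ η` and good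
balls in cell units `IsGoodBall`.  `…TwoThirdsNormalise` proves `TypicalSelectionNormalised → TypicalSelectionLarge` by the affine zoom, so the
analytic heart of S1a′ (the localised sharp inequality) is to be written at `M = λ = 1` against THIS statement.  HONEST FRAMING: a definition;
nothing is proved here; no summit is proved by a line. [folklore]
-/

noncomputable section

open scoped Topology InnerProductSpace RealInnerProductSpace ENNReal ContDiff
open MeasureTheory Filter Set Metric Function
open Literature.Analysis Literature.Analysis.FluidPDE
open Summit.NavierStokesRegularity.NavierStokesRegularity.Theorems.DepletionLadder.KStar.HalfSpace
open Summit.NavierStokesRegularity.NavierStokesRegularity.Theorems.DepletionLadder.KStar.BangBang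
open Summit.NavierStokesRegularity.NavierStokesRegularity.Theorems.NearExtremalTransiencePerFlow.LocalMaximiser

namespace Summit.NavierStokesRegularity.NavierStokesRegularity.Theorems.NearExtremalTransiencePerFlow.TwoThirds

-- the problem directory repeats the summit name (`NavierStokesRegularity/NavierStokesRegularity`)
set_option linter.dupNamespace false
set_option linter.style.longLine false

/-- The NORMALISED form of S1a′: `TypicalSelectionLarge` for fields of height `≤ 1` and Taylor length `lam w = 1`, with linear growth
`∫_{B(y,r)}|w|² ≤ A_E r`, goodness in the form `locGain κ⋆ 1 w φ ≤ η`, and good balls in cell units (`IsGoodBall`). -/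
def TypicalSelectionNormalised : Prop :=
  ∀ A : ℕ → ℝ, (∀ j, 1 ≤ A j) → ∀ A_E : ℝ, 0 < A_E → ∃ θ₀ K : ℝ, 0 < θ₀ ∧ 0 < K ∧ ∃ i₁ : ℕ,
    ∀ (R η : ℝ) (m : ℕ), 0 < R → 0 < η → ∃ ε₀ : ℝ, 0 < ε₀ ∧
    ∀ (w : E3 → E3) (B ε : ℝ), IsAdm w 1 B → IsReg A w 1 → 0 < Zen w → 0 < Wpa w → lam w = 1 → 0 ≤ ε → ε ≤ ε₀ →
      (kStar - ε) * Real.sqrt (Zen w) * Real.sqrt (Wpa w) ≤ Jst w →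
      (∀ (y : E3) (r : ℝ), 0 < r → ∫ x in Metric.ball y r, ‖w x‖ ^ 2 ≤ A_E * r) →
      ∃ x₀ : E3, θ₀ ≤ ‖curl w x₀‖ ∧
        (∀ φ : E3 → E3, IsTestAt w 1 φ → tsupport φ ⊆ Metric.ball x₀ R → locGain kStar 1 w φ ≤ η) ∧
        ∀ i : ℕ, i₁ ≤ i → i < m → ∃ (c : E3) (r : ℝ), dist c x₀ ≤ r / 2 ∧ (4 : ℝ) ^ i ≤ r ∧
          r ≤ 2 * (4 : ℝ) ^ i ∧ IsGoodBall w c r (K / (i + 1))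

end Summit.NavierStokesRegularity.NavierStokesRegularity.Theorems.NearExtremalTransiencePerFlow.TwoThirds

end
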